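import Summits.NavierStokesRegularity.NavierStokesRegularity.Theorems.ScenarioCensusTemporalSpectrumComplexDecay
import Summits.NavierStokesRegularity.NavierStokesRegularity.Theorems.ScenarioCensusModeRankShell
import HarnessLib

/-!
# LINE «temporal-spectrum» port, part 8/12: §K (c) `row_A1cs_holds`, nestings; §Q (a) the quasi-polynomial helpers `tendsto_filter_of_tendsto`, `tendsto_expPoly_smul`,
# `quasiPoly_coeff_eq_zero`

Re-homed for the scenario census (typer seat ns-census-typer-1 g8; the cells A1ex / A1po are MEMBERS OF RECORD «DECIDED IN KERNEL IN FILES» of row A1apT since census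
v1.69 and A1jb / A1cs / A1qx / A1cx since v1.71 (critic idea-crit-3 g6 PASS — no price 20:33:05Z, RE-STAMPs REV 2 → REV 3 → REV 4 22:13:50Z; ref ns-census-ref g8
PRE-CHECK ✓ §13.14 item 11 + items 19/20; lit §21.21 / §21.24 (a)); this port makes them TREE-decided): VERBATIM PORT of ns-idea-2 LINE g12-2 «temporal-spectrum»
REV 4, `pub/ideators/ns-idea-2/lines/temporal-spectrum/line-temporal-spectrum.lean` sha16 f2331f3a0765e1d4 (3431 l., lean check rc 0, 0 sorry), split for the
400-line rule into twelve parts `ScenarioCensusTemporalSpectrum{∅, Exponential, Oscillatory, OscillatoryRow, Jordan, Complex, ComplexDecay, ComplexRow, Quasi, QuasiGroup,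
QuasiRow, Head}` (chain imports).  Lean text VERBATIM in namespace `…Theorems.ScenarioCensus.TemporalSpectrum` (the line's `…Lines.TemporalSpectrum` re-homed);
port edits: the two `local notation "E3"` lines → one `abbrev E3` at namespace level and the bracket lines `section Rows` / `end Rows` dropped (no `variable`s
there; typer lint: no notation in port files), `@[conjecture]` on the OPEN head `Row_A1qp` (typed only), twenty-one one-line docstrings added (gate lint); the
lemmas the line shares VERBATIM with «mode-rank» / «floquet-meter» (§B spatial Liouville lemmas, the instrument `vortB` / `vortB_sum_sum`, the gauge
`tendsto_slice_atBot` / `eq_zero_of_curl_slice_const`, `laplacian_zero_apply`, `norm_curl_le_four_mul`) are taken BY NAME from those landed ports (listed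
below); `tendsto_typeI_bound` (twin of a landed tree lemma in a module the farm does not build) is not re-declared and its four uses carry the one-line
Mathlib proof inline (proof text only).  Statements untouched.

No census VALUE is moved here (row A1apT keeps its value; the members become TREE-decided by name); NS regularity is NOT proved; (L′) ⟨10661⟩ is
untouched; no summit statement is proved by this file. Lemmas that restate already-landed tree declarations are taken BY NAME (gate lint `dedup.landed`): `apply_eq_apply_of_harmonic_bounded` = `ModeRank.apply_eq_apply_of_harmonic_bounded`, `apply_eq_apply_of_curl_const` = `ModeRank.apply_eq_apply_of_curl_const`, `nonpos_of_laplacian_eq_mul` = `ModeRank.nonpos_of_laplacian_eq_mul`, `eq_zero_of_laplacian_eq_smul_of_pos` = `ModeRank.eq_zero_of_laplacian_eq_smul_of_pos`, `vortB` = `ModeRank.vortB`, `vortB_sum_sum` = `ModeRank.vortB_sum_sum`, `tendsto_slice_atBot` = `ModeRank.tendsto_slice_atBot`, `eq_zero_of_curl_slice_const` = `ModeRank.eq_zero_of_curl_slice_const`, `laplacian_zero_apply` = `ModeRank.laplacian_zero_fun`, `norm_curl_le_four_mul` = `FloquetMeter.norm_curl_le_four_mul`.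
-/

-- the summit and its single problem share the name `NavierStokesRegularity` (D-0017 nested layout)
set_option linter.dupNamespace false

noncomputable section

open Set Function Filter Topology

namespace Summit.NavierStokesRegularity.NavierStokesRegularity.Theorems.ScenarioCensus.TemporalSpectrum

open Literature.Analysis Literature.Analysis.FluidPDE InnerProductSpace
open Summit.NavierStokesRegularity.NavierStokesRegularity.Theorems (vorticity_eq_deriv_of_typeI)
open scoped Laplacian InnerProductSpace RealInnerProductSpace ContDiff

/-- **Row A1cs holds** (sorry-free): Steps 1–2 above; Step 3: the smallest vorticity-carrying real
part `r` is positive (Step 1), its linear group tends to zero (Step 3a), the frequencies separate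
(`trig_coeff_eq_zero`), leaving for the minimal carrier either the positive shell `Δω = rω` (real
rate) or the rotating shell system `Δω_ψ = rω_ψ + bω_χ`, `Δω_χ = rω_χ - bω_ψ` (complex rate) — no
bounded solutions (§C, §H); Step 4: curl-free slices and the KNSS gauge. -/
theorem row_A1cs_holds : Row_A1cs := by
  classical
  intro C u hu n a b ψ χ hb0 hinj hψ hχ hbψ hbχ hsl
  have hΦ : ∀ m, ContDiff ℝ 3 (csΦ ψ χ m) := by rintro (k | k); exacts [hψ k, hχ k]
  have hcΦ : ∀ m, ContDiff ℝ 2 (curl (csΦ ψ χ m)) := fun m => contDiff_curl (hΦ m)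
  have hdΦ : ∀ m, Differentiable ℝ (csΦ ψ χ m) := fun m => (hΦ m).differentiable (by norm_num)
  have hsl' : ∀ s < 0, ∀ y,
      u s y = ∑ m, (Real.exp (csν a m * s) * csT b s m) • csΦ ψ χ m y := by
    intro s hs y
    rw [hsl s hs y, Fintype.sum_sum_type, ← Finset.sum_add_distrib]
    refine Finset.sum_congr rfl fun k _ => ?_
    simp only [csν_inl, csν_inr, csT_inl, csT_inr, csΦ_inl, csΦ_inr, smul_add, smul_smul]
  have hslF : ∀ s < 0, u s = fun y => ∑ m, (Real.exp (csν a m * s) * csT b s m) • csΦ ψ χ m y :=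
    fun s hs => funext (hsl' s hs)
  have hcurl : ∀ s < 0, curl (u s)
      = fun y => ∑ m, (Real.exp (csν a m * s) * csT b s m) • curl (csΦ ψ χ m) y := by
    intro s hs; funext y; rw [hslF s hs]; exact curl_sum_smul' hdΦ _ y
  have hsin0 : ∀ k, b k = 0 → ∀ s, csT b s (Sum.inr k) = 0 := by
    intro k hk s; simp [csT_inr, hk]
  -- Steps 1 and 2
  have hdec := cs_decay hu hb0 hinj hsl'
  have hE := cs_identity hu hψ hχ hsl'
  -- ### Step 3: no mode carries vorticity
  have hcar : ∀ k, curl (ψ k) = 0 ∧ (b k ≠ 0 → curl (χ k) = 0) := by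
    by_contra hcon
    obtain ⟨k₁, hk₁⟩ := not_forall.1 hcon
    set S : Finset (Fin n) := Finset.univ.filter
      (fun k => ¬ (curl (ψ k) = 0 ∧ (b k ≠ 0 → curl (χ k) = 0))) with hS
    have hSne : S.Nonempty :=
      ⟨k₁, by simp only [hS, Finset.mem_filter, Finset.mem_univ, true_and]; exact hk₁⟩
    obtain ⟨ks, hksS, hmin⟩ := S.exists_min_image a hSne
    have hks : ¬ (curl (ψ ks) = 0 ∧ (b ks ≠ 0 → curl (χ ks) = 0)) := (Finset.mem_filter.1 hksS).2
    have hlow : ∀ k, a k < a ks → curl (ψ k) = 0 ∧ (b k ≠ 0 → curl (χ k) = 0) := by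
      intro k hk
      by_contra hk'
      have hkS : k ∈ S := by
        simp only [hS, Finset.mem_filter, Finset.mem_univ, true_and]
        exact hk'
      exact absurd (hmin k hkS) (not_le.2 hk)
    have hpos : 0 < a ks := by
      by_contra hle
      push Not at hle
      obtain ⟨h1, h2⟩ := hdec ks hle
      apply hks
      refine ⟨?_, fun hb => ?_⟩
      · have h0 : ψ ks = 0 := funext h1
        funext y; rw [h0]; exact curl_zero y
      · have h0 : χ ks = 0 := funext (h2 hb)
        funext y; rw [h0]; exact curl_zero y
    have hgrp := cs_group_tendsto hdec hlow hE
    have hInj : Set.InjOn b ↑(Finset.univ.filter (fun k => a k = a ks)) := by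
      intro k hk k' hk' hbb
      simp only [Finset.coe_filter, Finset.mem_univ, true_and, Set.mem_setOf_eq] at hk hk'
      exact hinj (Prod.ext (by simp [hk, hk']) hbb)
    have hksmem : ks ∈ Finset.univ.filter (fun k => a k = a ks) := by simp
    have key : ∀ z, csX a b ψ χ z ks = 0 ∧ (b ks ≠ 0 → csY a b ψ χ z ks = 0) := fun z =>
      trig_coeff_eq_zero (Finset.univ.filter (fun k => a k = a ks)) b (csX a b ψ χ z)
        (csY a b ψ χ z) (fun k _ => hb0 k) hInj (hgrp z) ks hksmem
    have hΔψ : ∀ z, (Δ (curl (ψ ks))) z = a ks • curl (ψ ks) z + b ks • curl (χ ks) z := by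
      intro z
      have h1 := (key z).1
      rw [csX_apply] at h1
      exact (sub_eq_zero.1 h1).symm
    have hΔχ : b ks ≠ 0 → ∀ z,
        (Δ (curl (χ ks))) z = a ks • curl (χ ks) z - b ks • curl (ψ ks) z := by
      intro hb z
      have h2 := (key z).2 hb
      rw [csY_apply] at h2
      exact (sub_eq_zero.1 h2).symm
    obtain ⟨A, hA⟩ := hbψ ks
    obtain ⟨B, hB⟩ := hbχ ks
    apply hks
    by_cases hbks : b ks = 0
    · -- a real rate: positive shell
      refine ⟨?_, fun h => (h hbks).elim⟩
      funext y
      refine ModeRank.eq_zero_of_laplacian_eq_smul_of_pos (hcΦ (Sum.inl ks)) hpos (fun z => ?_) hA y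
      have h1 := hΔψ z
      rw [hbks, zero_smul, add_zero] at h1
      exact h1
    · -- an oscillatory pair: rotating shell system
      have hp := eq_zero_of_laplacian_pair (hcΦ (Sum.inl ks)) (hcΦ (Sum.inr ks)) hpos hΔψ
        (hΔχ hbks) hA hB
      exact ⟨hp.1, fun _ => hp.2⟩
  -- ### Step 4: curl-free slices ⇒ zero (KNSS gauge)
  refine ModeRank.eq_zero_of_curl_slice_const hu fun t ht => ⟨0, fun x => ?_⟩
  rw [hcurl t ht]
  refine Finset.sum_eq_zero ?_
  rintro (k | k) -
  · simp [csΦ_inl, (hcar k).1]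
  · by_cases hbk : b k = 0
    · rw [hsin0 k hbk, mul_zero, zero_smul]
    · simp [csΦ_inr, (hcar k).2 hbk]

/-- **Nesting inside the line**: the complex-simple cell contains the real-simple cell `Row_A1ex`
(all frequencies zero). -/
theorem row_A1ex_of_row_A1cs (h : Row_A1cs) : Row_A1ex := by
  intro C u hu n σ φ hσ hφ hbd hsl
  refine h C u hu n σ (fun _ => 0) φ φ (fun _ => le_rfl) ?_ hφ hφ hbd hbd ?_
  · intro k k' hkk
    exact hσ (congrArg Prod.fst hkk)
  · intro t ht x
    rw [hsl t ht x]
    refine Finset.sum_congr rfl fun k _ => ?_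
    simp

/-- **Nesting inside the line**: the complex-simple cell contains the oscillatory pair `Row_A1cx`
(after normalising the frequency to be positive). -/
theorem row_A1cx_of_row_A1cs (h : Row_A1cs) : Row_A1cx := by
  intro C u hu a b ψ χ hb hψ hχ hbψ hbχ hsl
  rcases lt_or_gt_of_ne hb with hneg | hposb
  · have hχ' : ContDiff ℝ 3 (fun y => (-1 : ℝ) • χ y) := hχ.const_smul (-1 : ℝ)
    refine h C u hu 1 (fun _ => a) (fun _ => -b) (fun _ => ψ) (fun _ => fun y => (-1 : ℝ) • χ y)
      (fun _ => (neg_pos.2 hneg).le) (fun k k' _ => Subsingleton.elim k k') (fun _ => hψ)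
      (fun _ => hχ') (fun _ => hbψ) ?_ ?_
    · intro _
      obtain ⟨A, hA⟩ := hbχ
      refine ⟨A, fun x => ?_⟩
      rw [curl_const_smul ((hχ.differentiable (by norm_num)) x) (-1 : ℝ), norm_smul]
      simpa using hA x
    · intro t ht x
      rw [hsl t ht x]
      simp only [Finset.univ_unique, Fin.default_eq_zero, Fin.isValue, Finset.sum_singleton,
        neg_mul, Real.cos_neg, Real.sin_neg, smul_smul]
      module
  · refine h C u hu 1 (fun _ => a) (fun _ => b) (fun _ => ψ) (fun _ => χ)
      (fun _ => hposb.le) (fun k k' _ => Subsingleton.elim k k') (fun _ => hψ)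
      (fun _ => hχ) (fun _ => hbψ) (fun _ => hbχ) ?_
    intro t ht x
    rw [hsl t ht x]
    simp

/-- Bookkeeping (REV 3): the five decided temporal-spectrum cells of this line. -/
theorem temporalSpectrum_cells_decided₅ :
    Row_A1ex ∧ Row_A1po ∧ Row_A1cx ∧ Row_A1jb ∧ Row_A1cs :=
  ⟨row_A1ex_holds, row_A1po_holds, row_A1cx_holds, row_A1jb_holds, row_A1cs_holds⟩

/-! ## Q. The full explicit quasi-polynomial cell: Jordan blocks ⊗ oscillation (REV 3)

`u(t,x) = ∑ₖ ∑_{m<d} e^{aₖt} t^m (cos(bₖt) ψₖₘ(x) + sin(bₖt) χₖₘ(x))`, distinct rates `aₖ + i bₖ`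
(`bₖ ≥ 0`).  This is the general solution shape of a constant-coefficient linear ODE in `t`; modulo
the (textbook, not yet formalised) Jordan–Floquet representation it is the head `Row_A1qp`.  Lever:
(1″) dominant balance by real part with exponential-times-polynomial weights
(`tendsto_filter_of_tendsto`, `tendsto_expPoly_smul`), then the INDEPENDENCE OF QUASI-POLYNOMIALS at
`-∞` (`quasiPoly_coeff_eq_zero`: divide by the top power, `trig_coeff_eq_zero`, descend in the
degree); (2) the same spatial shells, now the rotating shell system with the Jordan coupling
`(m+1)ω_{m+1}`, descended from the top power. -/

/-- The part of a finite sum over a filter tends to zero if the whole sum does and every term outside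
the filter does. -/
theorem tendsto_filter_of_tendsto {ι : Type*} [Fintype ι] (p : ι → Prop) [DecidablePred p]
    (f : ι → ℝ → E3) (hoff : ∀ i, ¬ p i → Tendsto (f i) atBot (𝓝 0))
    (h : Tendsto (fun t => ∑ i, f i t) atBot (𝓝 0)) :
    Tendsto (fun t => ∑ i ∈ Finset.univ.filter p, f i t) atBot (𝓝 0) := by
  classical
  have hR : Tendsto (fun t => ∑ i ∈ Finset.univ.filter (fun i => ¬ p i), f i t) atBot (𝓝 0) := by
    rw [show (0 : E3) = ∑ i ∈ Finset.univ.filter (fun i => ¬ p i), (0 : E3) by simp]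
    refine tendsto_finsetSum _ fun i hi => ?_
    exact hoff i (Finset.mem_filter.1 hi).2
  have := h.sub hR
  rw [sub_zero] at this
  refine this.congr fun t => ?_
  rw [← Finset.sum_filter_add_sum_filter_not Finset.univ p, add_sub_cancel_right]

/-- An exponential beats a polynomial times bounded factors at `-∞`. -/
theorem tendsto_expPoly_smul {ε : ℝ} (hε : 0 < ε) (m : ℕ) (w : ℝ → ℝ) (W : ℝ)
    (hw : ∀ t, |w t| ≤ W) (V : ℝ → E3) (K : ℝ) (hV : ∀ t, ‖V t‖ ≤ K) :
    Tendsto (fun t : ℝ => (Real.exp (ε * t) * t ^ m * w t) • V t) atBot (𝓝 0) := by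
  have h1 : Tendsto (fun t : ℝ => ‖Real.exp (ε * t) * t ^ m‖ * (W * K)) atBot (𝓝 0) := by
    simpa using (tendsto_exp_mul_pow_atBot hε m).norm.mul_const (W * K)
  refine squeeze_zero_norm' (Eventually.of_forall fun t => ?_) h1
  rw [norm_smul, Real.norm_eq_abs, Real.norm_eq_abs, abs_mul]
  have hK : 0 ≤ K := (norm_nonneg _).trans (hV t)
  have hW : 0 ≤ W := (abs_nonneg _).trans (hw t)
  calc |Real.exp (ε * t) * t ^ m| * |w t| * ‖V t‖
      ≤ |Real.exp (ε * t) * t ^ m| * W * K :=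
        mul_le_mul (mul_le_mul_of_nonneg_left (hw t) (abs_nonneg _)) (hV t) (norm_nonneg _)
          (mul_nonneg (abs_nonneg _) hW)
    _ = |Real.exp (ε * t) * t ^ m| * (W * K) := by ring

/-- **Independence of quasi-polynomials at `-∞`.**  If
`∑ᵢ ∑_{m<d} t^m (cos(βᵢt) Xᵢₘ + sin(βᵢt) Yᵢₘ) → 0` as `t → -∞` with distinct frequencies `βᵢ ≥ 0`,
then every `Xᵢₘ` vanishes and every `Yᵢₘ` with `βᵢ ≠ 0` vanishes. -/
theorem quasiPoly_coeff_eq_zero {ι : Type*} (s : Finset ι) (β : ι → ℝ) (hβ : ∀ i ∈ s, 0 ≤ β i)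
    (hinj : Set.InjOn β s) :
    ∀ (d : ℕ) (X Y : ι → ℕ → E3),
      Tendsto (fun t : ℝ => ∑ i ∈ s, ∑ m ∈ Finset.range d,
        t ^ m • (Real.cos (β i * t) • X i m + Real.sin (β i * t) • Y i m)) atBot (𝓝 0) →
      ∀ i ∈ s, ∀ m < d, X i m = 0 ∧ (β i ≠ 0 → Y i m = 0) := by
  intro d
  induction d with
  | zero => intro X Y _ i _ m hm; exact absurd hm (Nat.not_lt_zero m)
  | succ d IH =>
    intro X Y h
    -- the top layer tends to zero
    have htop : Tendsto (fun t : ℝ => ∑ i ∈ s,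
        (Real.cos (β i * t) • X i d + Real.sin (β i * t) • Y i d)) atBot (𝓝 0) := by
      -- divide by `t ^ d`
      have h1 : Tendsto (fun t : ℝ => (t ^ d)⁻¹ • ∑ i ∈ s, ∑ m ∈ Finset.range (d + 1),
          t ^ m • (Real.cos (β i * t) • X i m + Real.sin (β i * t) • Y i m)) atBot (𝓝 0) := by
        refine squeeze_zero_norm' ?_ (tendsto_zero_iff_norm_tendsto_zero.1 h)
        filter_upwards [Iic_mem_atBot (-1 : ℝ)] with t ht
        have ht' : t ≤ -1 := ht
        rw [norm_smul]
        refine mul_le_of_le_one_left (norm_nonneg _) ?_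
        rw [norm_inv, norm_pow, Real.norm_eq_abs]
        have : 1 ≤ |t| := by rw [abs_of_neg (by linarith)]; linarith
        exact inv_le_one_of_one_le₀ (one_le_pow₀ this)
      -- the lower layers, divided by `t ^ d`, tend to zero
      have h2 : Tendsto (fun t : ℝ => ∑ i ∈ s, ∑ m ∈ Finset.range d,
          ((t ^ d)⁻¹ * t ^ m) • (Real.cos (β i * t) • X i m + Real.sin (β i * t) • Y i m))
          atBot (𝓝 0) := by
        rw [show (0 : E3) = ∑ i ∈ s, ∑ m ∈ Finset.range d, (0 : E3) by simp]
        refine tendsto_finsetSum _ fun i _ => tendsto_finsetSum _ fun m hm => ?_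
        have hmd : m < d := Finset.mem_range.1 hm
        have h0 : Tendsto (fun t : ℝ => |t|⁻¹) atBot (𝓝 0) := by
          have h00 := (tendsto_inv_atBot_zero (𝕜 := ℝ)).abs
          rw [abs_zero] at h00
          exact h00.congr fun t => abs_inv t
        have hK : Tendsto (fun t : ℝ => |t|⁻¹ * (‖X i m‖ + ‖Y i m‖)) atBot (𝓝 0) := by
          simpa using h0.mul_const (‖X i m‖ + ‖Y i m‖)
        refine squeeze_zero_norm' ?_ hK
        filter_upwards [Iic_mem_atBot (-1 : ℝ)] with t ht
        have ht' : t ≤ -1 := ht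
        have ht1 : 1 ≤ |t| := by rw [abs_of_neg (by linarith)]; linarith
        have ht0 : t ≠ 0 := by linarith
        have hta : 0 < |t| := abs_pos.2 ht0
        rw [norm_smul, Real.norm_eq_abs]
        refine mul_le_mul ?_ ?_ (norm_nonneg _) (inv_nonneg.2 (abs_nonneg _))
        · -- `|t^{-d} t^m| ≤ |t|⁻¹`
          rw [abs_mul, abs_inv, abs_pow, abs_pow]
          rw [inv_mul_le_iff₀ (pow_pos hta d)]
          obtain ⟨j, hj⟩ := Nat.exists_eq_add_of_lt hmd
          rw [hj, pow_add, pow_add, pow_one, mul_assoc, mul_inv_cancel₀ hta.ne', mul_one]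
          exact le_mul_of_one_le_right (pow_nonneg (abs_nonneg _) _) (one_le_pow₀ ht1)
        · calc ‖Real.cos (β i * t) • X i m + Real.sin (β i * t) • Y i m‖
              ≤ ‖Real.cos (β i * t) • X i m‖ + ‖Real.sin (β i * t) • Y i m‖ := norm_add_le _ _
            _ ≤ ‖X i m‖ + ‖Y i m‖ := by
                rw [norm_smul, norm_smul, Real.norm_eq_abs, Real.norm_eq_abs]
                exact add_le_add
                  (mul_le_of_le_one_left (norm_nonneg _) (Real.abs_cos_le_one _))
                  (mul_le_of_le_one_left (norm_nonneg _) (Real.abs_sin_le_one _))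
      have h3 := h1.sub h2
      rw [sub_zero] at h3
      refine h3.congr' ?_
      filter_upwards [Iic_mem_atBot (-1 : ℝ)] with t ht
      have ht' : t ≤ -1 := ht
      have ht0 : t ≠ 0 := by linarith
      rw [Finset.smul_sum, ← Finset.sum_sub_distrib]
      refine Finset.sum_congr rfl fun i _ => ?_
      rw [Finset.sum_range_succ, smul_add, Finset.smul_sum, smul_smul,
        inv_mul_cancel₀ (pow_ne_zero d ht0), one_smul]
      simp only [smul_smul]
      abel
    have hd : ∀ i ∈ s, X i d = 0 ∧ (β i ≠ 0 → Y i d = 0) :=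
      trig_coeff_eq_zero s β (fun i => X i d) (fun i => Y i d) hβ hinj htop
    -- remove the top layer and use the induction hypothesis
    have h' : Tendsto (fun t : ℝ => ∑ i ∈ s, ∑ m ∈ Finset.range d,
        t ^ m • (Real.cos (β i * t) • X i m + Real.sin (β i * t) • Y i m)) atBot (𝓝 0) := by
      refine h.congr fun t => ?_
      refine Finset.sum_congr rfl fun i hi => ?_
      rw [Finset.sum_range_succ, add_eq_left, (hd i hi).1, smul_zero, zero_add]
      by_cases hb : β i = 0
      · simp [hb]
      · rw [(hd i hi).2 hb, smul_zero, smul_zero]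
    intro i hi m hm
    rcases Nat.lt_succ_iff_lt_or_eq.1 hm with hm' | rfl
    · exact IH X Y h' i hi m hm'
    · exact hd i hi

end Summit.NavierStokesRegularity.NavierStokesRegularity.Theorems.ScenarioCensus.TemporalSpectrum

end
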